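import Summits.Ventures.CertifiedQuantumChemistry.Rows.GapCertificateCodimOne
import Summits.Ventures.CertifiedQuantumChemistry.Rows.ObservableRows
import Literature.MathematicalPhysics.QuantumChemistry.SectorRayleighRitz
import HarnessLib

/-!
# Rows/GroundStateOverlapRows.lean: CERTIFIED GROUND-STATE OVERLAP (mixing-angle) rows from energy
# certificates only — Eckart's criterion in certificate currency

HONEST FRAMING (verbatim): certified bounds for a stated model Hamiltonian in a stated basis; not a claim about
the real molecule or material beyond that model.

LADDER-CHEM I-TYPE (cell chem-oracle, seat chem-type-06 gen 5, offer (J); slot-06 lane = Rayleigh–Ritz in the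
sector + exact-`ℚ` CI records). The quantities the cell reports as REFERENCE-CHARACTER floats (`w₀` = weight of
the leading determinant / CI trial in the ground state) and the MIXING ANGLE `β` that every ground-state
expectation enclosure consumes (`TempleKato.abs_expect_sub_expect_le_of_residual`; the tree's Kato–Temple route
`Rows/DifferenceSlopeRows.forall_ground_abs_re_rayleigh_sub_le` feeds it from the trial state's SECOND moment
`‖Ĥw‖²`) have a certificate-grade source that needs NO second moment — ECKART'S CRITERION (Eckart 1930;
Goodisman 1973, Ch. III §A.2 eqs. (9)–(12), pp. 92–93): for a unit trial function `Φ` and the unit ground state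
`Ψ₀` of a Hamiltonian with ground energy `E₀` and first excited level `E₁`,
"`a₀² ≥ 1 − [(⟨Φ|H|Φ⟩ − E₀)/(E₁ − E₀)]`" (eq. (12)), `a₀ = ⟨Ψ₀|Φ⟩`. In the tree this inequality is
`TempleKato.sin_sq_mul_gap_le` («`(1 − |⟨ψ, w⟩|²)(σ − e) ≤ ρ − e`», Saad 1992 Ch. III Thm 3.9 form) — NOTHING is
re-derived here. This file is its ROW-LEVEL reading for the quantum-chemistry venture:
* `OverlapLowerRow F a b φ w` — for EVERY ground state `ψ` of the pinned file `F` in the sector `(a, b)`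
  (`Model.IsGroundState`, exactly the quantifier of `Rows/ObservableRows`): `cos² ∠(φ, ψ) ≥ w`, un-normalised
  as `w·⟨φ,φ⟩⟨ψ,ψ⟩ ≤ |⟨φ,ψ⟩|²`; with `φ = |D⟩` a determinant this is the REFERENCE WEIGHT row
  `w·‖ψ‖² ≤ |ψ(D)|²` (`OverlapLowerRow.weight_le`);
* SOUNDNESS `overlapLowerRow_of_gapCertificateCodimOne`: a codimension-one gap leg
  `GapCertificateCodimOne F a b σ` (door M1, `Rows/GapCertificateCodimOne`, imported — no gap object is
  defined or produced here), a sector-pure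
  `φ ≠ 0` with `Re⟨φ, Ĥφ⟩ ≤ ρ‖φ‖²`, an ordinary `LowerRow F a b ℓ`, `ρ < σ` and `w(σ − ℓ) ≤ σ − ρ` ⇒ the row
  (monotonicity: `E₁ ≥ σ`, `E₀ ≥ ℓ` only loosen Eckart's quotient); kernel entries `CIVec.overlapLowerRow`
  (decidable facts of an exact-`ℚ` CI record) and `overlapLowerRow_single_of_detEnergy` (`φ = |α↑β↓⟩`,
  `ρ = Model.detEnergy`, `Rows/DeterminantEnergy`);
* THE ANGLE WITHOUT `⟨Ĥ²⟩`: `one_sub_overlap_sq_mul_le_of_rows` / `one_sub_overlap_sq_le_of_rows` — every unit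
  sector ground eigenvector `ψ` and unit sector trial `w` with `Re⟨w, Ĥw⟩ ≤ ρ < σ` satisfy
  `(1 − |⟨w,ψ⟩|²)(σ − ℓ) ≤ ρ − ℓ`, i.e. `1 − |⟨w,ψ⟩|² ≤ β²` for any `β² ≥ (ρ − ℓ)/(σ − ℓ)` — and hence
  `forall_ground_abs_re_rayleigh_sub_le_of_lowerRow`: the expectation enclosure
  `|Re⟨ψ, Oψ⟩ − o| ≤ 2βs_O + β²(h + |o − m|)` of `Rows/DifferenceSlopeRows` with its second-moment hypotheses
  `(‖Ĥw‖² ≤ (r2 + ρ²)N, r2 ≤ β²(σ − ρ)²)` REPLACED by `(LowerRow F a b ℓ, ρ − ℓ ≤ β²(σ − ℓ))` — the SDP leg the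
  cell already buys instead of the `⟨Ĥ²⟩` purchase (chem-lead A15 (1)); its conclusion is literally the
  hypothesis `hslope`-shape of `diffUpperRow_of_forall_ground` / `diffLowerRow_of_forall_ground` there.
* `groundState_eq_smul_of_energy_lt_gap` / `_of_upperRow_lt`: certified NON-DEGENERACY of the sector ground
  level from `GapCertificateCodimOne σ` and `E₀ < σ` (an `UpperRow hi < σ`): any two ground states are parallel
  (the tree's `TempleKato.eq_smul_of_eigen`).
HONEST LIMITS (label T-HONEST «certified ground-state character of the MODEL's ground state in the pinned
basis», chem-lead B8-1): (i) informative only when a trial energy lies BELOW the certified gap leg (`ρ < σ`);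
(ii) `w` degrades with the LOWER-row slack (`σ − ℓ` in place of `σ − E₀`): the free angle
`β_E² = (ρ − ℓ)/(σ − ℓ)` is never better than the SDP width over the certified gap and tightens with the LOWER
rung, not with the trial state; (iii) an overlap/weight row says NOTHING about `⟨S²⟩` or any other observable by
itself (expectations need §5 with explicit observable data); it is a statement about the MODEL's ground state in
the pinned orbital basis, not about the molecule. NOT here: any producer, number or claim node; the generic
inequality (tree, cited); the difference-row wrappers (chem-type-09's `Rows/DifferenceSlopeRows`, one line from
`forall_ground_abs_re_rayleigh_sub_le_of_lowerRow`).
-/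

noncomputable section

namespace Summit.Ventures.CertifiedQuantumChemistry

open Matrix Finset
open Literature.MathematicalPhysics.QuantumLattice Literature.MathematicalPhysics.QuantumChemistry
open Literature.MathematicalPhysics.QuantumLattice.EigenvalueContinuation
open scoped ComplexOrder

variable {k : ℕ}

/-! ## §1 The OVERLAP row predicate -/

/-- **OVERLAP LOWER row** `cos² ∠(φ, ψ₀) ≥ w`: the sector `(a, b)` is physical and for EVERY ground state `ψ`
of the pinned file `F` in it (`Model.IsGroundState`: nonzero, sector-supported, energy expectation `= E₀`),
`w · ⟨φ, φ⟩ · ⟨ψ, ψ⟩ ≤ |⟨φ, ψ⟩|²` (un-normalised form of `|⟨φ̂, ψ̂⟩|² ≥ w`). `φ` is an explicit reference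
vector — a determinant `|D⟩` (then the row reads «the weight of `D` in every ground state is `≥ w`»,
`OverlapLowerRow.weight_le`) or the Fock vector of an exact-`ℚ` CI record. Eckart's `a₀²`, Goodisman (1973)
Ch. III §A.2 eqs. (10)–(12), pp. 92–93. Nothing is asserted; rows are proved by §3.
[cite: Goodisman1973, Ch. III §A.2 eqs. (10)–(12), pp. 92–93] -/
def OverlapLowerRow (F : Model k) (a b : ℕ) (φ : Fock (Orb (Fin k))) (w : ℚ) : Prop :=
  (a ≤ k ∧ b ≤ k) ∧ ∀ ψ : Fock (Orb (Fin k)), F.IsGroundState a b ψ →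
    ((w : ℚ) : ℝ) * ((star φ ⬝ᵥ φ).re * (star ψ ⬝ᵥ ψ).re) ≤ ‖star φ ⬝ᵥ ψ‖ ^ 2

namespace OverlapLowerRow

variable {F : Model k} {a b : ℕ} {φ : Fock (Orb (Fin k))} {w : ℚ}

/-- An overlap row carries the physical range `a ≤ k ∧ b ≤ k`.
[cite: Goodisman1973, Ch. III §A.2 eqs. (10)–(12), pp. 92–93] -/
theorem range (h : OverlapLowerRow F a b φ w) : a ≤ k ∧ b ≤ k := h.1

/-- Reading an overlap row at a ground state `ψ`: `w·⟨φ,φ⟩⟨ψ,ψ⟩ ≤ |⟨φ,ψ⟩|²`.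
[cite: Goodisman1973, Ch. III §A.2 eqs. (10)–(12), pp. 92–93] -/
theorem le (h : OverlapLowerRow F a b φ w) {ψ : Fock (Orb (Fin k))} (hψ : F.IsGroundState a b ψ) :
    ((w : ℚ) : ℝ) * ((star φ ⬝ᵥ φ).re * (star ψ ⬝ᵥ ψ).re) ≤ ‖star φ ⬝ᵥ ψ‖ ^ 2 :=
  h.2 ψ hψ

/-- Overlap rows weaken downwards in the slot `w`.
[cite: Goodisman1973, Ch. III §A.2 eqs. (10)–(12), pp. 92–93] -/
theorem mono (h : OverlapLowerRow F a b φ w) {w' : ℚ} (hle : w' ≤ w) : OverlapLowerRow F a b φ w' :=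
  ⟨h.1, fun ψ hψ => le_trans (mul_le_mul_of_nonneg_right (by exact_mod_cast hle)
    (mul_nonneg (re_star_dotProduct_self_nonneg φ) (re_star_dotProduct_self_nonneg ψ))) (h.2 ψ hψ)⟩

/-- No overlap row exceeds `1` (Cauchy–Schwarz `|⟨φ,ψ⟩|² ≤ ⟨φ,φ⟩⟨ψ,ψ⟩` at a ground state, which exists for a
symmetric file on the physical range): for `φ ≠ 0`, `OverlapLowerRow F a b φ w → w ≤ 1`. [folklore] -/
theorem le_one (hF : F.IsSymmetric) (h : OverlapLowerRow F a b φ w) (hφ : φ ≠ 0) : w ≤ 1 := by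
  obtain ⟨ψ, hψ, -⟩ := Model.exists_isGroundState hF h.1.1 h.1.2
  have hle := (h.2 ψ hψ).trans (norm_star_dotProduct_sq_le φ ψ)
  have hpos : 0 < (star φ ⬝ᵥ φ).re * (star ψ ⬝ᵥ ψ).re :=
    mul_pos (re_star_dotProduct_self_pos hφ) (re_star_dotProduct_self_pos hψ.2.1)
  have h1 : ((w : ℚ) : ℝ) ≤ 1 := le_of_mul_le_mul_right (by rwa [one_mul]) hpos
  exact_mod_cast h1

/-- **REFERENCE-WEIGHT reading.** For `φ = |D⟩` (a single determinant, `Pi.single D 1`) an overlap row says: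
every ground state `ψ` of `F` in `(a, b)` carries weight `|ψ(D)|² ≥ w·‖ψ‖²` on `D` — the certified counterpart
of the «leading-determinant weight `w₀`» float. [cite: Goodisman1973, Ch. III §A.2 eqs. (10)–(12), pp. 92–93] -/
theorem weight_le {D : Finset (Orb (Fin k))} (h : OverlapLowerRow F a b (Pi.single D 1) w)
    {ψ : Fock (Orb (Fin k))} (hψ : F.IsGroundState a b ψ) :
    ((w : ℚ) : ℝ) * (star ψ ⬝ᵥ ψ).re ≤ ‖ψ D‖ ^ 2 := by
  have h1 := h.2 ψ hψ
  rwa [Model.star_single_dotProduct, Model.star_single_dotProduct, Pi.single_eq_same, Complex.one_re,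
    one_mul] at h1

end OverlapLowerRow

/-! ## §2 Eckart's criterion in certificate currency (unit vectors) -/

/-- **A variational ground state of a symmetric file is a sector ground EIGENvector**: `Model.IsGroundState`
(energy expectation `= E₀·‖ψ‖²`, sector-supported, nonzero) gives `Ĥ(F)ψ = E₀(F; a, b)·ψ` — the equality case
of Rayleigh–Ritz on the `Ĥ(F)`-invariant sector (`mulVec_eq_minEnergyOn_smul_of_rayleigh_le`, Horn–Johnson
Thm 4.2.2 (b), p. 234). [cite: HornJohnson2013, Thm 4.2.2, p. 234] -/
theorem Model.IsGroundState.hamiltonian_mulVec {F : Model k} (hF : F.IsSymmetric) {a b : ℕ}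
    {ψ : Fock (Orb (Fin k))} (h : F.IsGroundState a b ψ) :
    F.hamiltonian *ᵥ ψ = ((F.energy a b : ℝ) : ℂ) • ψ := by
  have hE : F.energy a b = F.hamiltonian.minEnergyOn (szSector (a + b) (((a : ℝ) - b) / 2)) := rfl
  rw [hE]
  exact mulVec_eq_minEnergyOn_smul_of_rayleigh_le (Model.hamiltonian_isHermitian hF) _
    (fun x hx => molecularHamiltonian_mulVec_mem_szSector _ _ _ hx)
    ((mem_szSector_iff_isInSector a b ψ).2 h.1) (by rw [← hE]; exact le_of_eq h.2.2)

/-- **ECKART'S CRITERION FROM ROWS (unit vectors).** For a symmetric file `F`, a codimension-one gap leg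
`GapCertificateCodimOne F a b σ` (`σ ≤ λ₂(Ĥ(F) | sector)` counting multiplicity), a UNIT sector trial `w` with
`Re⟨w, Ĥ(F)w⟩ ≤ ρ < σ`, and a lower row `ℓ ≤ E₀(F; a, b)`: every UNIT sector ground eigenvector `ψ` satisfies
`(1 − |⟨w, ψ⟩|²)·(σ − ℓ) ≤ ρ − ℓ`. (The tree's `TempleKato.sin_sq_mul_gap_le` gives
`(1 − |⟨ψ,w⟩|²)(σ − E₀) ≤ Re⟨w,Ĥw⟩ − E₀` with the gap on `sector ∩ ψ^⊥` from
`TempleKato.gap_of_codimOne_certificate` (`E₀ ≤ ρ < σ`); replacing `E₀` by `ℓ ≤ E₀` on both sides only loosens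
it, since `1 − |⟨ψ,w⟩|² ≤ 1`.) Goodisman (1973) Ch. III §A.2 eqs. (9)–(12), pp. 92–93 (Eckart 1930).
[cite: Goodisman1973, Ch. III §A.2 eqs. (10)–(12), pp. 92–93] -/
theorem one_sub_overlap_sq_mul_le_of_rows {F : Model k} (hF : F.IsSymmetric) {a b : ℕ} {σ : ℚ}
    (hG : GapCertificateCodimOne F a b σ) {w : Fock (Orb (Fin k))} (hw : IsInSector a b w)
    (hw1 : star w ⬝ᵥ w = 1) {ρ : ℝ} (hρ : (star w ⬝ᵥ F.hamiltonian *ᵥ w).re ≤ ρ)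
    (hρσ : ρ < ((σ : ℚ) : ℝ)) {ℓ : ℚ} (hL : LowerRow F a b ℓ)
    {ψ : Fock (Orb (Fin k))} (hψ : IsInSector a b ψ) (hψ1 : star ψ ⬝ᵥ ψ = 1)
    (hHψ : F.hamiltonian *ᵥ ψ = ((F.energy a b : ℝ) : ℂ) • ψ) :
    (1 - ‖star w ⬝ᵥ ψ‖ ^ 2) * (((σ : ℚ) : ℝ) - ℓ) ≤ ρ - ℓ := by
  obtain ⟨W, u, hW, hWK⟩ := hG.exists_codimOne
  have hH : F.hamiltonian.IsHermitian := Model.hamiltonian_isHermitian hF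
  have hψK : ψ ∈ (szSector (a + b) (((a : ℝ) - b) / 2) : Submodule ℂ (Fock (Orb (Fin k)))) :=
    (mem_szSector_iff_isInSector a b ψ).2 hψ
  have hwK : w ∈ (szSector (a + b) (((a : ℝ) - b) / 2) : Submodule ℂ (Fock (Orb (Fin k)))) :=
    (mem_szSector_iff_isInSector a b w).2 hw
  have hE0ρ : F.energy a b ≤ ρ := (sectorGroundEnergy_le_re_rayleigh_of_unit hH hw hw1).trans hρ
  have hE0σ : F.energy a b < ((σ : ℚ) : ℝ) := hE0ρ.trans_lt hρσ
  have hgap : ∀ z ∈ (szSector (a + b) (((a : ℝ) - b) / 2) : Submodule ℂ (Fock (Orb (Fin k)))),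
      star ψ ⬝ᵥ z = 0 → ((σ : ℚ) : ℝ) * (star z ⬝ᵥ z).re ≤ (star z ⬝ᵥ F.hamiltonian *ᵥ z).re :=
    fun z hzK hz => TempleKato.gap_of_codimOne_certificate hH.eq hW hWK hψK hψ1 hHψ hE0σ hzK hz
  have key := TempleKato.sin_sq_mul_gap_le hH.eq hψ1 hHψ hψK hgap hwK hw1
  have hsym : ‖star w ⬝ᵥ ψ‖ = ‖star ψ ⬝ᵥ w‖ := by rw [star_dotProduct, norm_star]
  rw [hsym]
  have hx : 0 ≤ ‖star ψ ⬝ᵥ w‖ ^ 2 := by positivity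
  have hℓ : ((ℓ : ℚ) : ℝ) ≤ F.energy a b := hL.le
  nlinarith [mul_nonneg hx (sub_nonneg.2 hℓ)]

/-- **The mixing angle without a second moment.** Under the hypotheses of `one_sub_overlap_sq_mul_le_of_rows`,
any real `β` with `ρ − ℓ ≤ β²(σ − ℓ)` bounds the angle of EVERY unit sector ground eigenvector `ψ` to the trial:
`1 − |⟨w, ψ⟩|² ≤ β²` (`sin² ∠ ≤ β_E² = (ρ − ℓ)/(σ − ℓ)`). This is the `hover` input of the tree's
`TempleKato.abs_expect_sub_expect_le(_of_residual)`, supplied by an SDP lower row instead of `‖Ĥw‖²`.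
[cite: Goodisman1973, Ch. III §A.2 eqs. (10)–(12), pp. 92–93] -/
theorem one_sub_overlap_sq_le_of_rows {F : Model k} (hF : F.IsSymmetric) {a b : ℕ} {σ : ℚ}
    (hG : GapCertificateCodimOne F a b σ) {w : Fock (Orb (Fin k))} (hw : IsInSector a b w)
    (hw1 : star w ⬝ᵥ w = 1) {ρ : ℝ} (hρ : (star w ⬝ᵥ F.hamiltonian *ᵥ w).re ≤ ρ)
    (hρσ : ρ < ((σ : ℚ) : ℝ)) {ℓ : ℚ} (hL : LowerRow F a b ℓ) {β : ℝ}
    (hβ : ρ - ℓ ≤ β ^ 2 * (((σ : ℚ) : ℝ) - ℓ))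
    {ψ : Fock (Orb (Fin k))} (hψ : IsInSector a b ψ) (hψ1 : star ψ ⬝ᵥ ψ = 1)
    (hHψ : F.hamiltonian *ᵥ ψ = ((F.energy a b : ℝ) : ℂ) • ψ) :
    1 - ‖star w ⬝ᵥ ψ‖ ^ 2 ≤ β ^ 2 := by
  have h := one_sub_overlap_sq_mul_le_of_rows hF hG hw hw1 hρ hρσ hL hψ hψ1 hHψ
  have hE0ρ : F.energy a b ≤ ρ :=
    (sectorGroundEnergy_le_re_rayleigh_of_unit (Model.hamiltonian_isHermitian hF) hw hw1).trans hρ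
  have hσℓ : 0 < ((σ : ℚ) : ℝ) - ℓ := by linarith [hL.le]
  exact le_of_mul_le_mul_right (h.trans hβ) hσℓ

/-- **CERTIFIED NON-DEGENERACY of the sector ground level (energy form).** A codimension-one gap leg
`GapCertificateCodimOne F a b σ` with `E₀(F; a, b) < σ` (so `E₀ < σ ≤ λ₂` counting multiplicity) makes the ground
level of `Ĥ(F)` on the `(a, b)` sector SIMPLE: any two ground states (`Model.IsGroundState`) are parallel,
`ψ' = c•ψ`. The tree's `TempleKato.eq_smul_of_eigen` read at row level (today only docstring prose in
`Rows/GapCertificateCodimOne`). Horn–Johnson Thm 4.2.6 (Courant–Fischer step), p. 235.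
[cite: HornJohnson2013, Thm 4.2.6, p. 235] -/
theorem groundState_eq_smul_of_energy_lt_gap {F : Model k} (hF : F.IsSymmetric) {a b : ℕ} {σ : ℚ}
    (hG : GapCertificateCodimOne F a b σ) (hE0σ : F.energy a b < ((σ : ℚ) : ℝ))
    {ψ ψ' : Fock (Orb (Fin k))} (hψ : F.IsGroundState a b ψ) (hψ' : F.IsGroundState a b ψ') :
    ∃ c : ℂ, ψ' = c • ψ := by
  obtain ⟨W, u, hW, hWK⟩ := hG.exists_codimOne
  have hH : F.hamiltonian.IsHermitian := Model.hamiltonian_isHermitian hF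
  -- normalise `ψ`
  obtain ⟨c, hc, hcc, hc1⟩ := exists_normalize hψ.2.1
  have hψ₁K : ((c : ℂ) • ψ) ∈ (szSector (a + b) (((a : ℝ) - b) / 2) : Submodule ℂ (Fock (Orb (Fin k)))) :=
    (mem_szSector_iff_isInSector a b _).2 (hψ.1.smul _)
  have hHψ := hψ.hamiltonian_mulVec hF
  have hHψ₁ : F.hamiltonian *ᵥ ((c : ℂ) • ψ) = ((F.energy a b : ℝ) : ℂ) • ((c : ℂ) • ψ) := by
    rw [mulVec_smul, hHψ, smul_comm]
  have hgap : ∀ z ∈ (szSector (a + b) (((a : ℝ) - b) / 2) : Submodule ℂ (Fock (Orb (Fin k)))),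
      star ((c : ℂ) • ψ) ⬝ᵥ z = 0 →
        ((σ : ℚ) : ℝ) * (star z ⬝ᵥ z).re ≤ (star z ⬝ᵥ F.hamiltonian *ᵥ z).re :=
    fun z hzK hz => TempleKato.gap_of_codimOne_certificate hH.eq hW hWK hψ₁K hc1 hHψ₁ hE0σ hzK hz
  have hψ'K : ψ' ∈ (szSector (a + b) (((a : ℝ) - b) / 2) : Submodule ℂ (Fock (Orb (Fin k)))) :=
    (mem_szSector_iff_isInSector a b _).2 hψ'.1
  have h := TempleKato.eq_smul_of_eigen hc1 hHψ₁ hψ₁K hE0σ hgap hψ'K (hψ'.hamiltonian_mulVec hF)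
  exact ⟨(star ((c : ℂ) • ψ) ⬝ᵥ ψ') * (c : ℂ), by rw [← smul_smul]; exact h⟩

/-- **CERTIFIED NON-DEGENERACY from two rows**: `GapCertificateCodimOne F a b σ` and an ordinary upper row
`UpperRow F a b hi` with `hi < σ` (`E₀ ≤ hi < σ ≤ λ₂`) ⇒ any two ground states of `F` in `(a, b)` are parallel.
Row-level form of the simplicity conclusion of the tree's Kato–Temple apparatus; no trial-state moment is needed.
[cite: HornJohnson2013, Thm 4.2.6, p. 235] -/
theorem groundState_eq_smul_of_upperRow_lt {F : Model k} (hF : F.IsSymmetric) {a b : ℕ} {σ hi : ℚ}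
    (hG : GapCertificateCodimOne F a b σ) (hU : UpperRow F a b hi) (hlt : hi < σ)
    {ψ ψ' : Fock (Orb (Fin k))} (hψ : F.IsGroundState a b ψ) (hψ' : F.IsGroundState a b ψ') :
    ∃ c : ℂ, ψ' = c • ψ :=
  groundState_eq_smul_of_energy_lt_gap hF hG (hU.le.trans_lt (by exact_mod_cast hlt)) hψ hψ'

/-! ## §3 Soundness of the row (un-normalised reference vector, every ground state) -/

/-- Scaling both arguments of a pairing by real scalars: `|⟨dφ, cψ⟩|² = d²c²|⟨φ, ψ⟩|²`. [folklore] -/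
private theorem norm_sq_star_smul_dotProduct_smul (d c : ℝ) (φ ψ : Fock (Orb (Fin k))) :
    ‖star ((d : ℂ) • φ) ⬝ᵥ ((c : ℂ) • ψ)‖ ^ 2 = (d * d) * (c * c) * ‖star φ ⬝ᵥ ψ‖ ^ 2 := by
  rw [star_smul, smul_dotProduct, dotProduct_smul, smul_smul, smul_eq_mul, norm_mul, norm_mul,
    Complex.star_def, Complex.conj_ofReal, Complex.norm_real, Complex.norm_real, Real.norm_eq_abs,
    Real.norm_eq_abs, mul_pow, mul_pow, sq_abs, sq_abs]
  ring

/-- **OVERLAP ROW FROM ROWS (Eckart's criterion, soundness).** For a symmetric file `F`: a codimension-one gap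
leg `GapCertificateCodimOne F a b σ`, an explicit NONZERO sector-pure reference vector `φ` with
`Re⟨φ, Ĥ(F)φ⟩ ≤ ρ·⟨φ, φ⟩` (its Rayleigh quotient is `≤ ρ`), an ordinary lower row `LowerRow F a b ℓ`, `ρ < σ`,
and a rational slot `w` with `w·(σ − ℓ) ≤ σ − ρ` give `OverlapLowerRow F a b φ w`: every ground state of `F` in
`(a, b)` has `cos² ∠(φ, ψ) ≥ w`. (Normalise `φ` and the ground state, which is an eigenvector by
`Model.IsGroundState.hamiltonian_mulVec`; apply `one_sub_overlap_sq_mul_le_of_rows`; un-normalise.)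
"`a₀² ≥ 1 − (⟨Φ|H|Φ⟩ − E₀)/(E₁ − E₀)`" with `E₁ ≥ σ`, `E₀ ≥ ℓ`: Goodisman (1973) Ch. III §A.2 eq. (12), p. 93.
[cite: Goodisman1973, Ch. III §A.2 eqs. (10)–(12), pp. 92–93] -/
theorem overlapLowerRow_of_gapCertificateCodimOne {F : Model k} (hF : F.IsSymmetric) {a b : ℕ} {σ : ℚ}
    (hG : GapCertificateCodimOne F a b σ) {φ : Fock (Orb (Fin k))} (hφ : IsInSector a b φ) (hφ0 : φ ≠ 0)
    {ρ : ℚ} (hρ : (star φ ⬝ᵥ F.hamiltonian *ᵥ φ).re ≤ ((ρ : ℚ) : ℝ) * (star φ ⬝ᵥ φ).re)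
    {ℓ : ℚ} (hL : LowerRow F a b ℓ) (hρσ : ρ < σ) {w : ℚ} (hw : w * (σ - ℓ) ≤ σ - ρ) :
    OverlapLowerRow F a b φ w := by
  refine ⟨range_of_isInSector_ne_zero hφ hφ0, fun ψ hψ => ?_⟩
  obtain ⟨d, hd, hdd, hd1⟩ := exists_normalize hφ0
  obtain ⟨c, hc, hcc, hc1⟩ := exists_normalize hψ.2.1
  have hHψ := hψ.hamiltonian_mulVec hF
  have hHψ₁ : F.hamiltonian *ᵥ ((c : ℂ) • ψ) = ((F.energy a b : ℝ) : ℂ) • ((c : ℂ) • ψ) := by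
    rw [mulVec_smul, hHψ, smul_comm]
  have hρ₁ : (star ((d : ℂ) • φ) ⬝ᵥ F.hamiltonian *ᵥ ((d : ℂ) • φ)).re ≤ ((ρ : ℚ) : ℝ) := by
    rw [re_star_smul_dotProduct_mulVec_smul]
    calc d * d * (star φ ⬝ᵥ F.hamiltonian *ᵥ φ).re
        ≤ d * d * (((ρ : ℚ) : ℝ) * (star φ ⬝ᵥ φ).re) := mul_le_mul_of_nonneg_left hρ (mul_self_nonneg d)
      _ = ((ρ : ℚ) : ℝ) := by rw [← mul_assoc, mul_comm (d * d), mul_assoc, hdd, mul_one]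
  have key := one_sub_overlap_sq_mul_le_of_rows hF hG (hφ.smul _) hd1 hρ₁ (by exact_mod_cast hρσ) hL
    (hψ.1.smul _) hc1 hHψ₁
  rw [norm_sq_star_smul_dotProduct_smul] at key
  have hw' : ((w : ℚ) : ℝ) * (((σ : ℚ) : ℝ) - ℓ) ≤ ((σ : ℚ) : ℝ) - ρ := by exact_mod_cast hw
  have hE0ρ : F.energy a b ≤ ((ρ : ℚ) : ℝ) :=
    sectorGroundEnergy_le_of_rayleigh (Model.hamiltonian_isHermitian hF) hφ hφ0 hρ
  have hσℓ : 0 < ((σ : ℚ) : ℝ) - ℓ := by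
    have : ((ρ : ℚ) : ℝ) < σ := by exact_mod_cast hρσ
    linarith [hL.le]
  have h1 : ((w : ℚ) : ℝ) * (((σ : ℚ) : ℝ) - ℓ) ≤
      (d * d) * (c * c) * ‖star φ ⬝ᵥ ψ‖ ^ 2 * (((σ : ℚ) : ℝ) - ℓ) := by linarith
  have h2 : ((w : ℚ) : ℝ) ≤ (d * d) * (c * c) * ‖star φ ⬝ᵥ ψ‖ ^ 2 := le_of_mul_le_mul_right h1 hσℓ
  have hn : 0 ≤ (star φ ⬝ᵥ φ).re * (star ψ ⬝ᵥ ψ).re :=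
    mul_nonneg (re_star_dotProduct_self_nonneg φ) (re_star_dotProduct_self_nonneg ψ)
  calc ((w : ℚ) : ℝ) * ((star φ ⬝ᵥ φ).re * (star ψ ⬝ᵥ ψ).re)
      ≤ (d * d) * (c * c) * ‖star φ ⬝ᵥ ψ‖ ^ 2 * ((star φ ⬝ᵥ φ).re * (star ψ ⬝ᵥ ψ).re) :=
        mul_le_mul_of_nonneg_right h2 hn
    _ = (d * d * (star φ ⬝ᵥ φ).re) * (c * c * (star ψ ⬝ᵥ ψ).re) * ‖star φ ⬝ᵥ ψ‖ ^ 2 := by ring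
    _ = ‖star φ ⬝ᵥ ψ‖ ^ 2 := by rw [hdd, hcc, one_mul, one_mul]

/-! ## §4 Kernel entries: exact-`ℚ` CI record and single determinant -/

/-- **KERNEL ENTRY FOR A CI REFERENCE VECTOR.** For a symmetric file `F`, a gap leg
`GapCertificateCodimOne F a b σ`, a lower row `LowerRow F a b ℓ`, and an exact-`ℚ` CI record `v` whose
DECIDABLE facts hold — sector-pure determinants, `0 < normSq`, `energy ≤ ρ·normSq`, `ρ < σ`,
`w·(σ − ℓ) ≤ σ − ρ` — every ground state `ψ` of `F` in `(a, b)` has `cos² ∠(v, ψ) ≥ w`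
(`OverlapLowerRow F a b v.vec w`; bridges `CIVec.star_vec_dotProduct_hamiltonian_mulVec` /
`star_vec_dotProduct_vec` of `Rows/CIUpperBound`).
[cite: Goodisman1973, Ch. III §A.2 eqs. (10)–(12), pp. 92–93] -/
theorem CIVec.overlapLowerRow {n : ℕ} {F : Model k} (hF : F.IsSymmetric) (v : CIVec k n) {a b : ℕ}
    {σ : ℚ} (hG : GapCertificateCodimOne F a b σ) (hsec : v.InSector a b) (hpos : 0 < v.normSq)
    {ρ : ℚ} (hle : v.energy F ≤ ρ * v.normSq) {ℓ : ℚ} (hL : LowerRow F a b ℓ) (hρσ : ρ < σ)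
    {w : ℚ} (hw : w * (σ - ℓ) ≤ σ - ρ) : OverlapLowerRow F a b v.vec w :=
  overlapLowerRow_of_gapCertificateCodimOne hF hG (CIVec.isInSector_vec hsec)
    (CIVec.vec_ne_zero_of_normSq_pos hpos)
    (by
      rw [CIVec.star_vec_dotProduct_hamiltonian_mulVec, CIVec.star_vec_dotProduct_vec,
        Complex.ratCast_re, Complex.ratCast_re]
      exact_mod_cast hle)
    hL hρσ hw

/-- **KERNEL ENTRY FOR A SINGLE DETERMINANT (the reference-determinant weight).** For a symmetric file `F`, a
gap leg `GapCertificateCodimOne F a b σ` in the sector `(a, b) = (|α|, |β|)`, a lower row `LowerRow F a b ℓ`,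
and the exact rational determinant energy `E_F(α, β) = Model.detEnergy F α β` (`Rows/DeterminantEnergy`,
Slater–Condon diagonal rule) with `E_F(α, β) < σ` and `w·(σ − ℓ) ≤ σ − E_F(α, β)`: every ground state `ψ` of
`F` in `(a, b)` carries weight `|ψ(α↑β↓)|² ≥ w·‖ψ‖²` on `|α↑β↓⟩` (`OverlapLowerRow.weight_le`). Informative
only when the determinant energy lies below the certified gap leg.
[cite: Goodisman1973, Ch. III §A.2 eqs. (10)–(12), pp. 92–93] -/
theorem overlapLowerRow_single_of_detEnergy {F : Model k} (hF : F.IsSymmetric) {α β : Finset (Fin k)}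
    {a b : ℕ} (ha : α.card = a) (hb : β.card = b) {σ : ℚ} (hG : GapCertificateCodimOne F a b σ)
    {ℓ : ℚ} (hL : LowerRow F a b ℓ) (hρσ : F.detEnergy α β < σ) {w : ℚ}
    (hw : w * (σ - ℓ) ≤ σ - F.detEnergy α β) :
    OverlapLowerRow F a b (Pi.single (pairSet α β) 1) w := by
  subst ha hb
  refine overlapLowerRow_of_gapCertificateCodimOne hF hG (isInSector_single_pairSet α β) ?_ ?_ hL hρσ hw
  · intro h0
    have := congrFun h0 (pairSet α β)
    simp at this
  · rw [Model.star_single_dotProduct, Model.star_single_dotProduct, Model.hamiltonian_mulVec_single_self,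
      Pi.single_eq_same, Complex.one_re, mul_one, Complex.ratCast_re]

/-! ## §5 The expectation enclosure fed by a lower row (no second moment) -/

/-- **GROUND-STATE EXPECTATION ENCLOSURE WITHOUT `⟨Ĥ²⟩`.** Row-level inputs, un-normalised exact sums, the
statement shape of `Rows/DifferenceSlopeRows.forall_ground_abs_re_rayleigh_sub_le` with its second-moment
hypotheses replaced by a LOWER ROW: a symmetric file `F`; a gap leg `GapCertificateCodimOne F a b σ`; one
explicit sector vector `w` with `N = ⟨w, w⟩ > 0` and `Re⟨w, Ĥ(F)w⟩ ≤ ρN`, `ρ < σ`; `LowerRow F a b ℓ`; a Hermitian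
observable `O` with a form bound `|⟨x, (O − m)x⟩| ≤ h‖x‖²`, exact data `Re⟨w, Ow⟩ = oN`, `‖Ow − o·w‖² ≤ s_O²·N`
(`s_O ≥ 0`); and `β ≥ 0` with `ρ − ℓ ≤ β²(σ − ℓ)`. Then every UNIT `(a, b)`-sector ground eigenvector `ψ` of
`Ĥ(F)` has `|Re⟨ψ, Oψ⟩ − o| ≤ 2βs_O + β²(h + |o − m|)` (angle from `one_sub_overlap_sq_le_of_rows`, mixing
bound = the tree's `TempleKato.abs_expect_sub_expect_le_of_residual`). With `O = Ĥ(F_A) − Ĥ(F_B)` this is the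
`hslope` hypothesis of `diffUpperRow_of_forall_ground` (`F = F_B`) / `diffLowerRow_of_forall_ground`
(`F = F_A`) of `Rows/DifferenceSlopeRows` — first-order difference rows from an SDP leg, an upper trial and a
gap leg, no `⟨Ĥ²⟩`. [cite: Saad1992, Ch. III §3.2 Thm 3.9] -/
theorem forall_ground_abs_re_rayleigh_sub_le_of_lowerRow {F : Model k} (hF : F.IsSymmetric) {a b : ℕ}
    {σ : ℚ} (hG : GapCertificateCodimOne F a b σ) {w : Fock (Orb (Fin k))} (hw : IsInSector a b w)
    {N ρ : ℝ} (hN : 0 < N) (hwN : (star w ⬝ᵥ w).re = N)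
    (hρ : (star w ⬝ᵥ F.hamiltonian *ᵥ w).re ≤ ρ * N) (hρσ : ρ < ((σ : ℚ) : ℝ))
    {ℓ : ℚ} (hL : LowerRow F a b ℓ)
    {O : Matrix (Finset (Orb (Fin k))) (Finset (Orb (Fin k))) ℂ} (hO : O.IsHermitian)
    {o m h β sO : ℝ}
    (hOform : ∀ x : Fock (Orb (Fin k)),
      ‖star x ⬝ᵥ O *ᵥ x - (m : ℂ) * (star x ⬝ᵥ x)‖ ≤ h * (star x ⬝ᵥ x).re)
    (ho : (star w ⬝ᵥ O *ᵥ w).re = o * N) (hsO : 0 ≤ sO)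
    (hres : (star (O *ᵥ w - (o : ℂ) • w) ⬝ᵥ (O *ᵥ w - (o : ℂ) • w)).re ≤ sO ^ 2 * N)
    (hβ : 0 ≤ β) (hβℓ : ρ - ℓ ≤ β ^ 2 * (((σ : ℚ) : ℝ) - ℓ))
    {ψ : Fock (Orb (Fin k))} (hψ : IsInSector a b ψ) (hψ1 : star ψ ⬝ᵥ ψ = 1)
    (hHψ : F.hamiltonian *ᵥ ψ = ((F.energy a b : ℝ) : ℂ) • ψ) :
    |(star ψ ⬝ᵥ O *ᵥ ψ).re - o| ≤ 2 * β * sO + β ^ 2 * (h + |o - m|) := by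
  -- normalise the trial vector
  have hw0 : w ≠ 0 := by
    rintro rfl
    rw [dotProduct_zero, Complex.zero_re] at hwN
    exact hN.ne' hwN.symm
  obtain ⟨c, hc, hcc, hc1⟩ := exists_normalize hw0
  rw [hwN] at hcc
  set w' : Fock (Orb (Fin k)) := (c : ℂ) • w with hw'
  have hw'sec : IsInSector a b w' := hw.smul _
  have hρ' : (star w' ⬝ᵥ F.hamiltonian *ᵥ w').re ≤ ρ := by
    rw [hw', re_star_smul_dotProduct_mulVec_smul]
    calc c * c * (star w ⬝ᵥ F.hamiltonian *ᵥ w).re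
        ≤ c * c * (ρ * N) := mul_le_mul_of_nonneg_left hρ (mul_self_nonneg c)
      _ = ρ := by rw [← mul_assoc, mul_comm (c * c), mul_assoc, hcc, mul_one]
  have ho' : (star w' ⬝ᵥ O *ᵥ w').re = o := by
    rw [hw', re_star_smul_dotProduct_mulVec_smul, ho, ← mul_assoc, mul_comm (c * c), mul_assoc, hcc,
      mul_one]
  have hres' : (star (O *ᵥ w' - ((star w' ⬝ᵥ O *ᵥ w').re : ℂ) • w') ⬝ᵥ
      (O *ᵥ w' - ((star w' ⬝ᵥ O *ᵥ w').re : ℂ) • w')).re ≤ sO ^ 2 := by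
    rw [ho']
    have e1 : O *ᵥ w' - (o : ℂ) • w' = (c : ℂ) • (O *ᵥ w - (o : ℂ) • w) := by
      rw [hw', mulVec_smul, smul_sub, smul_comm]
    rw [e1, star_real_smul_dotProduct_real_smul, Complex.re_ofReal_mul]
    calc c * c * (star (O *ᵥ w - (o : ℂ) • w) ⬝ᵥ (O *ᵥ w - (o : ℂ) • w)).re
        ≤ c * c * (sO ^ 2 * N) := mul_le_mul_of_nonneg_left hres (mul_self_nonneg c)
      _ = sO ^ 2 := by rw [← mul_assoc, mul_comm (c * c), mul_assoc, hcc, mul_one]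
  -- the angle from the lower row (Eckart), then the mixing bound
  have hover : 1 - ‖star w' ⬝ᵥ ψ‖ ^ 2 ≤ β ^ 2 :=
    one_sub_overlap_sq_le_of_rows hF hG hw'sec hc1 hρ' hρσ hL hβℓ hψ hψ1 hHψ
  have key := TempleKato.abs_expect_sub_expect_le_of_residual hO.eq hOform hψ1 hc1 hβ hover hsO hres'
  rw [ho'] at key
  exact key

end Summit.Ventures.CertifiedQuantumChemistry

end
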